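import Mathlib
import HarnessLib
import Literature.MathematicalPhysics.QuantumLattice.SectorisedKernelNormExtraction
import Literature.MathematicalPhysics.QuantumLattice.HubbardInteractionKernels

/-!
# Route `KLProgramme` — ENGINE (stmt-HubbardSuperconductivity-20437 `KLRegimeEngineV17F2`), row (b) binders #5 (E4) / #6 `hplainE1`: THE PLAIN POSITION-SPACE
# QUARTIC KERNEL OF THE BARE VERTEX ON THE `2M` SPACE-TIME LATTICE — exact form `W₄(V)(x) = (U(βL²)⁻³/4!)·S_time(t)·L⁶·𝟙[x⃗₀ = x⃗₁ = x⃗₂ = x⃗₃]` and the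
# plain pinned currency `ε_x³Σ_{x′: x′_q = y}‖W₄(V)(x′)‖ = (|U|/24)·(2M)⁻³·Σ_{t : t_q = y₀}|S_time(t)|` (located candidate «(b)-PLAIN-UV-TAIL», evidence #43)
# (cell gate-hubbard-kl, seat hubbard-kl-k3c2-p2 g33)

The tree's bare vertex `hubbardInteraction L M β U` conserves the INTEGER Matsubara labels (`n₀ + n₂ = n₁ + n₃` in `ℤ`; the frequency-umklapp terms of the
time-lattice-local vertex are absent).  Consequently its plain (`trivialMultiplier`) position-space quartic kernel is local in SPACE (torus conservation) but in
imaginary TIME it is the trigonometric sum `S_time(t) = Σ_{n : n₀+n₂ = n₁+n₃} e^{−iω_{n₀}t₀} e^{+iω_{n₁}t₁} e^{−iω_{n₂}t₂} e^{+iω_{n₃}t₃}` over the ALLOWED label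
quadruples only — not `(2M)³·δδδ`.  This module proves the exact identities (no estimate):
* `klbv_vertexPattern_legs` — the vertex pattern's label string is `vertexLegs`;
* `klbv_spaceSum_eq` — the constrained character sum `Σ_{b₀+b₂=b₁+b₃} χ̄_{b₀}(z₀)χ_{b₁}(z₁)χ̄_{b₂}(z₂)χ_{b₃}(z₃) = L⁶·𝟙[z₀ = z₃ ∧ z₁ = z₃ ∧ z₂ = z₃]`;
* **`klbv_positionKernel_hubbardInteraction_eq`** — `W₄(V)(x) = (U(βL²)⁻³·(4!)⁻¹)·S_time(x₀-components)·(L⁶·𝟙[spatial coincidence])`;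
* **`klbv_plainCurrency_hubbardInteraction_eq`** — `ε_x³·Σ_{x′ : x′_q = y}‖W₄(V)(x′)‖ = (|U|/24)·(2M)⁻³·Σ_{t : t_q = y₀}|S_time(t)|` for every pinned leg `q` and point `y`.
The normalised sum `Θ_M = (2M)⁻³Σ_t|S_time(t)|` is `M`-dependent ([float] kit j339225: `3.79, 7.08, 11.47, 16.98, 23.63, 31.45, 40.43` at `M = 2…128`), whereas full
(modular) conservation would give `Θ = 1`; the row-(b) binders (E4)/`hplainE1` bound this currency of `𝒱_i ⊇ V` with `M`-free constants — see the located memo.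
Pure algebra on tree definitions; no estimate, no definition; nothing asserts (b), K3 or superconductivity.
References: BGM 2006 §2.1 (2.5)–(2.6a), §2.3 (2.17) [cite: BenfattoGiulianiMastropietro2006]; Salmhofer 1999 §4.2.4 (4.55)–(4.63) [cite: Salmhofer1999].
-/

noncomputable section

namespace Summit.HubbardSuperconductivity.HubbardSuperconductivity.Theorems.KLRegimeSplit

set_option linter.dupNamespace false -- summit = problem name (single-conjunct summit), D-0017

open Finset Literature.MathematicalPhysics.QuantumLattice Literature.Probability.LatticeModels GrassmannAlgebra
open scoped ComplexConjugate

variable {L M : ℕ} [NeZero L]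

/-! ## §1 The vertex pattern and the kernel at its label strings -/

omit [NeZero L] in
/-- The label string of the vertex pattern `(↑+, ↑−, ↓+, ↓−)` with momenta `k` IS `vertexLegs k`. -/
theorem klbv_vertexPattern_legs (k : Fin 4 → FreqMomentum L M) :
    (fun i => ((k i, ((![(((0 : Fin 1), (0 : Fin 2)), (0 : Fin 2)), ((0, 0), 1), ((0, 1), 0), ((0, 1), 1)] : Fin 4 → SectorLeg 1) i).1.2),
      ((![(((0 : Fin 1), (0 : Fin 2)), (0 : Fin 2)), ((0, 0), 1), ((0, 1), 0), ((0, 1), 1)] : Fin 4 → SectorLeg 1) i).2) : Fin 4 → HubbardFieldIdx L M) =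
      vertexLegs L M k := by
  funext i
  fin_cases i <;> rfl

/-- The quartic momentum kernel of `V` at the vertex pattern with momenta `k`: `[cons k]·U(βL²)⁻³·(4!)⁻¹`. -/
theorem klbv_kernel_vertexPattern (β U : ℝ) (k : Fin 4 → FreqMomentum L M) :
    kernel ℂ (hubbardInteraction L M β U) 4
        (fun i => ((k i, ((![(((0 : Fin 1), (0 : Fin 2)), (0 : Fin 2)), ((0, 0), 1), ((0, 1), 0), ((0, 1), 1)] : Fin 4 → SectorLeg 1) i).1.2),
          ((![(((0 : Fin 1), (0 : Fin 2)), (0 : Fin 2)), ((0, 0), 1), ((0, 1), 0), ((0, 1), 1)] : Fin 4 → SectorLeg 1) i).2)) =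
      (if vertexConserving L M k then (((U / (β * (L : ℝ) ^ 2) ^ 3 : ℝ)) : ℂ) else 0) * (((4 : ℕ).factorial : ℚ)⁻¹ • (1 : ℂ)) := by
  rw [klbv_vertexPattern_legs, kernel_hubbardInteraction_vertexLegs]

/-! ## §2 The spatial character sum collapses to the coincidence indicator -/

/-- `Σ_a χ̄_a(z) χ_a(w) = L²·[w = z]` (orthogonality over the character index). -/
theorem klbv_sum_conj_mul (z w : TorusSite 2 L) :
    ∑ a : TorusSite 2 L, conj (torusChar a z) * torusChar a w = if w = z then ((L : ℂ) ^ 2) else 0 := by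
  have h := sum_torusChar_left (d := 2) (L := L) (w - z)
  simp_rw [torusChar_sub_right] at h
  rw [show (∑ a : TorusSite 2 L, conj (torusChar a z) * torusChar a w) = ∑ a : TorusSite 2 L, torusChar a w * conj (torusChar a z) from
    sum_congr rfl fun a _ => mul_comm _ _, h]
  by_cases hw : w = z
  · rw [if_pos (sub_eq_zero.mpr hw), if_pos hw]
  · rw [if_neg (fun h' => hw (sub_eq_zero.mp h')), if_neg hw]

/-- `Σ_a χ_a(z) χ̄_a(w) = L²·[z = w]`. -/
theorem klbv_sum_mul_conj (z w : TorusSite 2 L) :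
    ∑ a : TorusSite 2 L, torusChar a z * conj (torusChar a w) = if z = w then ((L : ℂ) ^ 2) else 0 := by
  have h := sum_torusChar_left (d := 2) (L := L) (z - w)
  simp_rw [torusChar_sub_right] at h
  rw [h]
  by_cases hw : z = w
  · rw [if_pos (sub_eq_zero.mpr hw), if_pos hw]
  · rw [if_neg (fun h' => hw (sub_eq_zero.mp h')), if_neg hw]

/-- `χ_{a + c − b}(z) = χ_a(z)·χ_c(z)·χ̄_b(z)`. -/
theorem klbv_torusChar_add_sub_left (a b c z : TorusSite 2 L) :
    torusChar (a + c - b) z = torusChar a z * torusChar c z * conj (torusChar b z) := by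
  rw [torusChar_sub_left, torusChar_comm (a + c) z, torusChar_add_right, torusChar_comm z a, torusChar_comm z c]

/-- **The constrained spatial character sum**: for the vertex pattern's charges `(+,−,+,−)`,
`Σ_{b : b₀ + b₂ = b₁ + b₃} χ̄_{b₀}(z₀)·χ_{b₁}(z₁)·χ̄_{b₂}(z₂)·χ_{b₃}(z₃) = L⁶·𝟙[z₀ = z₃ ∧ z₁ = z₃ ∧ z₂ = z₃]`. -/
theorem klbv_spaceSum_eq (z : Fin 4 → TorusSite 2 L) :
    ∑ b : Fin 4 → TorusSite 2 L,
        (if b 0 + b 2 = b 1 + b 3 then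
          conj (torusChar (b 0) (z 0)) * torusChar (b 1) (z 1) * conj (torusChar (b 2) (z 2)) * torusChar (b 3) (z 3) else 0) =
      if z 0 = z 3 ∧ z 1 = z 3 ∧ z 2 = z 3 then ((L : ℂ) ^ 6) else 0 := by
  rw [sum_pi_fin_four]
  simp only [Matrix.cons_val_zero, Matrix.cons_val_one, Matrix.cons_val]
  -- innermost sum: `d = a + c − b`
  have hinner : ∀ a b c : TorusSite 2 L,
      (∑ d : TorusSite 2 L, if a + c = b + d then
          conj (torusChar a (z 0)) * torusChar b (z 1) * conj (torusChar c (z 2)) * torusChar d (z 3) else 0) =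
        conj (torusChar a (z 0)) * torusChar b (z 1) * conj (torusChar c (z 2)) * torusChar (a + c - b) (z 3) := by
    intro a b c
    have hcond : ∀ d : TorusSite 2 L, (a + c = b + d) ↔ (d = a + c - b) := fun d => by
      constructor
      · intro h; rw [h]; abel
      · intro h; rw [h]; abel
    simp_rw [hcond]
    rw [sum_ite_eq' univ (a + c - b)]
    simp
  simp_rw [hinner, klbv_torusChar_add_sub_left]
  -- regroup into three independent character sums
  have hre : ∀ a b c : TorusSite 2 L,
      conj (torusChar a (z 0)) * torusChar b (z 1) * conj (torusChar c (z 2)) *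
          (torusChar a (z 3) * torusChar c (z 3) * conj (torusChar b (z 3))) =
        (conj (torusChar a (z 0)) * torusChar a (z 3)) * ((torusChar b (z 1) * conj (torusChar b (z 3))) *
          (conj (torusChar c (z 2)) * torusChar c (z 3))) := by
    intro a b c; ring
  simp_rw [hre, ← mul_sum, ← sum_mul]
  rw [klbv_sum_conj_mul, klbv_sum_mul_conj, klbv_sum_conj_mul]
  by_cases h0 : z 0 = z 3
  · by_cases h1 : z 1 = z 3
    · by_cases h2 : z 2 = z 3
      · rw [if_pos (show z 3 = z 0 from h0.symm), if_pos (show z 1 = z 3 from h1), if_pos (show z 3 = z 2 from h2.symm),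
          if_pos (show z 0 = z 3 ∧ z 1 = z 3 ∧ z 2 = z 3 from ⟨h0, h1, h2⟩)]; ring
      · rw [if_neg (show ¬ (z 3 = z 2) from fun h => h2 h.symm), mul_zero, mul_zero,
          if_neg (show ¬ (z 0 = z 3 ∧ z 1 = z 3 ∧ z 2 = z 3) from fun h => h2 h.2.2)]
    · rw [if_neg (show ¬ (z 1 = z 3) from h1), zero_mul, mul_zero,
        if_neg (show ¬ (z 0 = z 3 ∧ z 1 = z 3 ∧ z 2 = z 3) from fun h => h1 h.2.1)]
  · rw [if_neg (show ¬ (z 3 = z 0) from fun h => h0 h.symm), zero_mul,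
      if_neg (show ¬ (z 0 = z 3 ∧ z 1 = z 3 ∧ z 2 = z 3) from fun h => h0 h.1)]

/-! ## §3 The plain position-space quartic kernel of `V`: time sum × spatial coincidence -/

/-- The product of the vertex pattern's spatial factors, written out. -/
theorem klbv_prod_spaceFactor (b z : Fin 4 → TorusSite 2 L) :
    (∏ i : Fin 4, (if ((![(((0 : Fin 1), (0 : Fin 2)), (0 : Fin 2)), ((0, 0), 1), ((0, 1), 0), ((0, 1), 1)] : Fin 4 → SectorLeg 1) i).2 = 0 then conj (torusChar (b i) (z i)) else torusChar (b i) (z i))) =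
      conj (torusChar (b 0) (z 0)) * torusChar (b 1) (z 1) * conj (torusChar (b 2) (z 2)) * torusChar (b 3) (z 3) := by
  rw [Fin.prod_univ_four]
  simp

/-- **The plain position-space quartic kernel of the bare vertex** at the vertex pattern `(↑+, ↑−, ↓+, ↓−)`:
`W₄(V)(x) = (U(βL²)⁻³·(4!)⁻¹) · S_time(x) · (L⁶·𝟙[x⃗₀ = x⃗₃ ∧ x⃗₁ = x⃗₃ ∧ x⃗₂ = x⃗₃])`, where
`S_time(x) = Σ_{n : n₀+n₂ = n₁+n₃ (in ℤ)} ∏_i e^{−i s_i ω_{n_i} t_{x_i}}` runs over the ALLOWED (integer-conserving, kept) Matsubara quadruples only. -/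
theorem klbv_positionKernel_hubbardInteraction_eq (β U : ℝ) (x : Fin 4 → SpaceTimeIdx L M) :
    sectorisedKernel L M β (trivialMultiplier L M) (hubbardInteraction L M β U) 4 (![(((0 : Fin 1), (0 : Fin 2)), (0 : Fin 2)), ((0, 0), 1), ((0, 1), 0), ((0, 1), 1)] : Fin 4 → SectorLeg 1) x =
      ((((U / (β * (L : ℝ) ^ 2) ^ 3 : ℝ)) : ℂ) * (((4 : ℕ).factorial : ℚ)⁻¹ • (1 : ℂ))) *
        ((∑ n : Fin 4 → MatsubaraIdx M,
            if matsubaraInt M (n 0) + matsubaraInt M (n 2) = matsubaraInt M (n 1) + matsubaraInt M (n 3) then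
              ∏ i : Fin 4, Complex.exp (-((chargeSign ((![(((0 : Fin 1), (0 : Fin 2)), (0 : Fin 2)), ((0, 0), 1), ((0, 1), 0), ((0, 1), 1)] : Fin 4 → SectorLeg 1) i).2 * (matsubaraFreq β M (n i) * imagTime β M (x i).1) : ℝ) : ℂ) * Complex.I)
            else 0) *
          (if (x 0).2 = (x 3).2 ∧ (x 1).2 = (x 3).2 ∧ (x 2).2 = (x 3).2 then ((L : ℂ) ^ 6) else 0)) := by
  rw [sectorisedKernel_def]
  -- the multiplier is `1`; the kernel at the vertex pattern
  have hterm : ∀ k : Fin 4 → FreqMomentum L M,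
      (∏ i, trivialMultiplier L M ((![(((0 : Fin 1), (0 : Fin 2)), (0 : Fin 2)), ((0, 0), 1), ((0, 1), 0), ((0, 1), 1)] : Fin 4 → SectorLeg 1) i).1.1 (k i) * hubbardPlaneWave L M β ((![(((0 : Fin 1), (0 : Fin 2)), (0 : Fin 2)), ((0, 0), 1), ((0, 1), 0), ((0, 1), 1)] : Fin 4 → SectorLeg 1) i).2 (k i) (x i)) *
          kernel ℂ (hubbardInteraction L M β U) 4 (fun i => ((k i, ((![(((0 : Fin 1), (0 : Fin 2)), (0 : Fin 2)), ((0, 0), 1), ((0, 1), 0), ((0, 1), 1)] : Fin 4 → SectorLeg 1) i).1.2), ((![(((0 : Fin 1), (0 : Fin 2)), (0 : Fin 2)), ((0, 0), 1), ((0, 1), 0), ((0, 1), 1)] : Fin 4 → SectorLeg 1) i).2)) =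
        ((((U / (β * (L : ℝ) ^ 2) ^ 3 : ℝ)) : ℂ) * (((4 : ℕ).factorial : ℚ)⁻¹ • (1 : ℂ))) *
          (if vertexConserving L M k then ∏ i, hubbardPlaneWave L M β ((![(((0 : Fin 1), (0 : Fin 2)), (0 : Fin 2)), ((0, 0), 1), ((0, 1), 0), ((0, 1), 1)] : Fin 4 → SectorLeg 1) i).2 (k i) (x i) else 0) := by
    intro k
    rw [klbv_kernel_vertexPattern]
    simp only [trivialMultiplier, one_mul]
    split_ifs <;> ring
  simp_rw [hterm]
  rw [← mul_sum]
  congr 1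
  -- split the label sum into Matsubara labels and torus momenta
  rw [← Equiv.sum_comp (Equiv.arrowProdEquivProdArrow (Fin 4) (fun _ => MatsubaraIdx M) (fun _ => TorusSite 2 L)).symm, Fintype.sum_prod_type]
  have hsplit : ∀ (n : Fin 4 → MatsubaraIdx M) (b : Fin 4 → TorusSite 2 L),
      (if vertexConserving L M ((Equiv.arrowProdEquivProdArrow (Fin 4) (fun _ => MatsubaraIdx M) (fun _ => TorusSite 2 L)).symm (n, b)) then
          ∏ i, hubbardPlaneWave L M β ((![(((0 : Fin 1), (0 : Fin 2)), (0 : Fin 2)), ((0, 0), 1), ((0, 1), 0), ((0, 1), 1)] : Fin 4 → SectorLeg 1) i).2 (((Equiv.arrowProdEquivProdArrow (Fin 4) (fun _ => MatsubaraIdx M) (fun _ => TorusSite 2 L)).symm (n, b)) i) (x i)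
        else 0) =
        (if matsubaraInt M (n 0) + matsubaraInt M (n 2) = matsubaraInt M (n 1) + matsubaraInt M (n 3) then
            ∏ i : Fin 4, Complex.exp (-((chargeSign ((![(((0 : Fin 1), (0 : Fin 2)), (0 : Fin 2)), ((0, 0), 1), ((0, 1), 0), ((0, 1), 1)] : Fin 4 → SectorLeg 1) i).2 * (matsubaraFreq β M (n i) * imagTime β M (x i).1) : ℝ) : ℂ) * Complex.I)
          else 0) *
        (if b 0 + b 2 = b 1 + b 3 then
            ∏ i : Fin 4, (if ((![(((0 : Fin 1), (0 : Fin 2)), (0 : Fin 2)), ((0, 0), 1), ((0, 1), 0), ((0, 1), 1)] : Fin 4 → SectorLeg 1) i).2 = 0 then conj (torusChar (b i) (x i).2) else torusChar (b i) (x i).2) else 0) := by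
    intro n b
    have he : ∀ i, ((Equiv.arrowProdEquivProdArrow (Fin 4) (fun _ => MatsubaraIdx M) (fun _ => TorusSite 2 L)).symm (n, b)) i = (n i, b i) := fun i => rfl
    simp only [vertexConserving, he]
    simp_rw [hubbardPlaneWave_eq, prod_mul_distrib]
    by_cases hT : matsubaraInt M (n 0) + matsubaraInt M (n 2) = matsubaraInt M (n 1) + matsubaraInt M (n 3)
    · by_cases hS : b 0 + b 2 = b 1 + b 3
      · rw [if_pos ⟨hT, hS⟩, if_pos hT, if_pos hS]
      · rw [if_neg (fun h => hS h.2), if_pos hT, if_neg hS, mul_zero]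
    · rw [if_neg (fun h => hT h.1), if_neg hT, zero_mul]
  simp_rw [hsplit]
  rw [← sum_mul_sum]
  congr 1
  simp_rw [klbv_prod_spaceFactor]
  exact klbv_spaceSum_eq (fun i => (x i).2)

/-! ## §4 The plain pinned currency of `V`: `ε_x³·Σ_{x′ : x′_q = y}‖W₄(V)(x′)‖ = (|U|/24)·Θ_M(q, y₀)` -/

/-- Only the constant tuple is pinned at `w` and spatially coincident: `Σ_{z : z_q = w} c·𝟙[z₀ = z₃ ∧ z₁ = z₃ ∧ z₂ = z₃] = c`. -/
theorem klbv_sum_coincidence {R : Type*} [AddCommMonoid R] (q : Fin 4) (w : TorusSite 2 L) (c : R) :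
    ∑ z : Fin 4 → TorusSite 2 L, (if z q = w then (if z 0 = z 3 ∧ z 1 = z 3 ∧ z 2 = z 3 then c else 0) else 0) = c := by
  rw [Finset.sum_eq_single (fun _ => w)]
  · simp
  · intro z _ hz
    by_cases hq : z q = w
    · rw [if_pos hq, if_neg]
      rintro ⟨h0, h1, h2⟩
      apply hz
      have h3 : z 3 = w := by
        rw [← hq]; fin_cases q
        · exact h0.symm
        · exact h1.symm
        · exact h2.symm
        · rfl
      funext i
      fin_cases i
      · exact h0.trans h3
      · exact h1.trans h3
      · exact h2.trans h3
      · exact h3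
    · rw [if_neg hq]
  · intro h; exact absurd (mem_univ _) h

omit [NeZero L] in
/-- Norm of the spatial coincidence factor. -/
theorem klbv_norm_coincidence (z : Fin 4 → TorusSite 2 L) :
    ‖(if z 0 = z 3 ∧ z 1 = z 3 ∧ z 2 = z 3 then ((L : ℂ) ^ 6) else 0)‖ = if z 0 = z 3 ∧ z 1 = z 3 ∧ z 2 = z 3 then ((L : ℝ) ^ 6) else 0 := by
  split_ifs <;> simp

/-- **Splitting a pinned position sum** whose summand is (time function) × (spatial coincidence indicator): only the constant spatial tuple survives. -/
theorem klbv_pinned_split (G : (Fin 4 → SpaceTimeIdx L M) → ℝ) (F : (Fin 4 → ImagTimeIdx M) → ℝ) (c : ℝ) (q : Fin 4) (y : SpaceTimeIdx L M)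
    (hG : ∀ x, G x = F (fun i => (x i).1) * (if (x 0).2 = (x 3).2 ∧ (x 1).2 = (x 3).2 ∧ (x 2).2 = (x 3).2 then c else 0)) :
    ∑ x ∈ univ.filter (fun x : Fin 4 → SpaceTimeIdx L M => x q = y), G x =
      c * ∑ t ∈ univ.filter (fun t : Fin 4 → ImagTimeIdx M => t q = y.1), F t := by
  rw [sum_filter, sum_filter, mul_sum,
    ← Equiv.sum_comp (Equiv.arrowProdEquivProdArrow (Fin 4) (fun _ => ImagTimeIdx M) (fun _ => TorusSite 2 L)).symm, Fintype.sum_prod_type]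
  refine sum_congr rfl fun t _ => ?_
  have he : ∀ (z : Fin 4 → TorusSite 2 L) (i : Fin 4),
      ((Equiv.arrowProdEquivProdArrow (Fin 4) (fun _ => ImagTimeIdx M) (fun _ => TorusSite 2 L)).symm (t, z)) i = (t i, z i) := fun _ _ => rfl
  simp only [hG, he]
  by_cases ht : t q = y.1
  · rw [if_pos ht]
    have hcond : ∀ z : Fin 4 → TorusSite 2 L, ((t q, z q) = y) ↔ (z q = y.2) := fun z => by
      rw [Prod.ext_iff]; simp [ht]
    simp_rw [hcond]
    have hz : ∀ z : Fin 4 → TorusSite 2 L,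
        (if z q = y.2 then F t * (if z 0 = z 3 ∧ z 1 = z 3 ∧ z 2 = z 3 then c else 0) else 0) =
        F t * (if z q = y.2 then (if z 0 = z 3 ∧ z 1 = z 3 ∧ z 2 = z 3 then c else 0) else 0) := by
      intro z; split_ifs <;> simp
    simp_rw [hz]
    rw [← mul_sum, klbv_sum_coincidence, mul_comm]
  · rw [if_neg ht, mul_zero]
    refine sum_eq_zero fun z _ => ?_
    rw [if_neg]
    intro h
    exact ht (congrArg Prod.fst h)

/-- **THE PLAIN PINNED CURRENCY OF THE BARE VERTEX** (the (E4)/`hplainE1` currency of row (b) at `trivialMultiplier`, evaluated on `V` at the vertex pattern,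
any pinned leg `q` at any point `y`, `0 < β`):
`ε_x³ · Σ_{x′ : x′_q = y} ‖W₄(V)(x′)‖ = (|U|/24) · (2M)⁻³ · Σ_{t : t_q = y₀} |S_time(t)|` — the normalised `L¹` mass `Θ_M` of the ALLOWED-quadruple trigonometric sum
(which would be `1` under full modular conservation) multiplies `|U|/24`.  `Θ_M` depends on `M` only; its growth is the located candidate «(b)-PLAIN-UV-TAIL». -/
theorem klbv_plainCurrency_hubbardInteraction_eq [NeZero M] {β : ℝ} (hβ : 0 < β) (U : ℝ) (q : Fin 4) (y : SpaceTimeIdx L M) :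
    imagTimeWeight β M ^ 3 *
        ∑ x ∈ univ.filter (fun x : Fin 4 → SpaceTimeIdx L M => x q = y),
          ‖sectorisedKernel L M β (trivialMultiplier L M) (hubbardInteraction L M β U) 4 (![(((0 : Fin 1), (0 : Fin 2)), (0 : Fin 2)), ((0, 0), 1), ((0, 1), 0), ((0, 1), 1)] : Fin 4 → SectorLeg 1) x‖ =
      |U| / 24 * ((((2 * M : ℕ) : ℝ) ^ 3)⁻¹ *
        ∑ t ∈ univ.filter (fun t : Fin 4 → ImagTimeIdx M => t q = y.1),
          ‖∑ n : Fin 4 → MatsubaraIdx M,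
              if matsubaraInt M (n 0) + matsubaraInt M (n 2) = matsubaraInt M (n 1) + matsubaraInt M (n 3) then
                ∏ i : Fin 4, Complex.exp (-((chargeSign ((![(((0 : Fin 1), (0 : Fin 2)), (0 : Fin 2)), ((0, 0), 1), ((0, 1), 0), ((0, 1), 1)] : Fin 4 → SectorLeg 1) i).2 * (matsubaraFreq β M (n i) * imagTime β M (t i)) : ℝ) : ℂ) * Complex.I)
              else 0‖) := by
  have hL : (0 : ℝ) < L := by exact_mod_cast Nat.pos_of_ne_zero (NeZero.ne L)
  have hM : (0 : ℝ) < ((2 * M : ℕ) : ℝ) := by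
    have := NeZero.ne M
    exact_mod_cast (by omega : 0 < 2 * M)
  -- the time sum as a function of the time labels
  set S : (Fin 4 → ImagTimeIdx M) → ℂ := fun t => ∑ n : Fin 4 → MatsubaraIdx M,
      if matsubaraInt M (n 0) + matsubaraInt M (n 2) = matsubaraInt M (n 1) + matsubaraInt M (n 3) then
        ∏ i : Fin 4, Complex.exp (-((chargeSign ((![(((0 : Fin 1), (0 : Fin 2)), (0 : Fin 2)), ((0, 0), 1), ((0, 1), 0), ((0, 1), 1)] : Fin 4 → SectorLeg 1) i).2 * (matsubaraFreq β M (n i) * imagTime β M (t i)) : ℝ) : ℂ) * Complex.I)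
      else 0 with hSdef
  -- the constant
  have h24 : (((4 : ℕ).factorial : ℚ)⁻¹ • (1 : ℂ)) = ((24 : ℂ))⁻¹ := by
    rw [Rat.smul_one_eq_cast]; push_cast; norm_num [Nat.factorial]
  have hK : ‖((((U / (β * (L : ℝ) ^ 2) ^ 3 : ℝ)) : ℂ) * (((4 : ℕ).factorial : ℚ)⁻¹ • (1 : ℂ)))‖ = |U| / (β * (L : ℝ) ^ 2) ^ 3 / 24 := by
    rw [h24, norm_mul, Complex.norm_real, norm_inv, Real.norm_eq_abs, abs_div, abs_of_pos (by positivity : (0 : ℝ) < (β * (L : ℝ) ^ 2) ^ 3)]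
    norm_num [div_eq_mul_inv]
  -- pointwise norm of the kernel
  have hx : ∀ x : Fin 4 → SpaceTimeIdx L M,
      ‖sectorisedKernel L M β (trivialMultiplier L M) (hubbardInteraction L M β U) 4 (![(((0 : Fin 1), (0 : Fin 2)), (0 : Fin 2)), ((0, 0), 1), ((0, 1), 0), ((0, 1), 1)] : Fin 4 → SectorLeg 1) x‖ =
        (fun t : Fin 4 → ImagTimeIdx M => |U| / (β * (L : ℝ) ^ 2) ^ 3 / 24 * ‖S t‖) (fun i => (x i).1) *
          (if (x 0).2 = (x 3).2 ∧ (x 1).2 = (x 3).2 ∧ (x 2).2 = (x 3).2 then ((L : ℝ) ^ 6) else 0) := by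
    intro x
    rw [klbv_positionKernel_hubbardInteraction_eq, norm_mul, hK, norm_mul, klbv_norm_coincidence (fun i => (x i).2)]
    simp only [hSdef]
    ring
  rw [klbv_pinned_split _ (fun t : Fin 4 → ImagTimeIdx M => |U| / (β * (L : ℝ) ^ 2) ^ 3 / 24 * ‖S t‖) ((L : ℝ) ^ 6) q y hx, ← mul_sum,
    imagTimeWeight]
  show _ = |U| / 24 * ((((2 * M : ℕ) : ℝ) ^ 3)⁻¹ * ∑ t ∈ univ.filter (fun t : Fin 4 → ImagTimeIdx M => t q = y.1), ‖S t‖)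
  have hβ0 : β ≠ 0 := hβ.ne'
  push_cast
  field_simp

/-- **Weighted form (the binders' literal left-hand sides carry a weight `≥ 1`, e.g. `klScaleWt`)**: for any weight `w ≥ 1` on position tuples,
`(|U|/24)·(2M)⁻³·Σ_{t : t_q = y₀}|S_time(t)| ≤ ε_x³·Σ_{x′ : x′_q = y} w(x′)·‖W₄(V)(x′)‖` (`0 < β`). -/
theorem klbv_plainCurrency_hubbardInteraction_le_weighted [NeZero M] {β : ℝ} (hβ : 0 < β) (U : ℝ) (q : Fin 4) (y : SpaceTimeIdx L M)
    (w : (Fin 4 → SpaceTimeIdx L M) → ℝ) (hw : ∀ x, 1 ≤ w x) :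
    |U| / 24 * ((((2 * M : ℕ) : ℝ) ^ 3)⁻¹ *
        ∑ t ∈ univ.filter (fun t : Fin 4 → ImagTimeIdx M => t q = y.1),
          ‖∑ n : Fin 4 → MatsubaraIdx M,
              if matsubaraInt M (n 0) + matsubaraInt M (n 2) = matsubaraInt M (n 1) + matsubaraInt M (n 3) then
                ∏ i : Fin 4, Complex.exp (-((chargeSign ((![(((0 : Fin 1), (0 : Fin 2)), (0 : Fin 2)), ((0, 0), 1), ((0, 1), 0), ((0, 1), 1)] : Fin 4 → SectorLeg 1) i).2 * (matsubaraFreq β M (n i) * imagTime β M (t i)) : ℝ) : ℂ) * Complex.I)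
              else 0‖) ≤
      imagTimeWeight β M ^ 3 *
        ∑ x ∈ univ.filter (fun x : Fin 4 → SpaceTimeIdx L M => x q = y),
          w x * ‖sectorisedKernel L M β (trivialMultiplier L M) (hubbardInteraction L M β U) 4 (![(((0 : Fin 1), (0 : Fin 2)), (0 : Fin 2)), ((0, 0), 1), ((0, 1), 0), ((0, 1), 1)] : Fin 4 → SectorLeg 1) x‖ := by
  rw [← klbv_plainCurrency_hubbardInteraction_eq hβ U q y]
  have hε : 0 ≤ imagTimeWeight β M ^ 3 := pow_nonneg (imagTimeWeight_nonneg hβ.le M) 3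
  refine mul_le_mul_of_nonneg_left (sum_le_sum fun x _ => ?_) hε
  exact le_mul_of_one_le_left (norm_nonneg _) (hw x)

end Summit.HubbardSuperconductivity.HubbardSuperconductivity.Theorems.KLRegimeSplit

end
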